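import Summits.ABC.StewartYu.PadicG3SatLevelStepH
import Summits.ABC.StewartYu.PadicG3Schedule
import HarnessLib

/-!
# Cell abc-stewartyu, WP-L.P(odd) (crux r3 `PadicCoreOddRat`, stmt-ABC-20503): the half-step RECORD PACKAGE of the saturated frame and the
# LEVEL SCHEDULE (`LevelStateSat`, `levelUp`, `levels`)

`Summits/ABC/StewartYu/PadicG3SatSchedule.lean` — cell `abc-stewartyu` (HOME `run/shared/lean/pub/abc-stewartyu/`, design memo
HOME/p2/memo-07-WPLP-odd-Nframe-design.md §2 rows «half-step algebra» / «ceilings»; seat p2-g6).  Definitions (`htermSW`, `HalfStepHypSatU`,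
`LevelStateSat` — the last two `Prop`-valued) and theorems on `G3Setup`; no named fact, no parameters.

* `HalfStepHypSatU F R R′ U L Bv P m N N₁ T T′` — the landed `HalfStepHypU` with the summand `htermW` (natural root exponents on the θ-box)
  replaced by the SIGNED summand `htermSW R s₁ τ i w = Hasse·∏zγ(w)^τ·∏ θⱼ^{⌊wⱼ s₁/2⌋}`, quantified uniformly over `i ∈ U` and over all `w` in
  BOTH boxes (θ-box `|wⱼ| ≤ Lⱼ` for the directional part, virtual box `|ν(w)ⱼ| ≤ Bvⱼ` for the monomial part — cleared by `SatData.Dh`);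
  `LvInvSatI.halfStep_of_hypU`;
* `LevelStateSat F H Ŝ Lc sv U pv P m lev N T` — some sub-family of `U`, exponents injective in `i.2`, satisfying `LvInvSatI` with the level-`lev`
  polynomials `Rl H Ŝ lev`, θ-box `Lb Lc lev` and virtual box `Lb sv lev` (both iterated halvings); `levelUp`, **`levels`**.

WHAT THIS IS NOT: the START (level `0` state) and the output; no crux moves.

References: Yu. V. Nesterenko, LNM 1819 (2003) Prop. 4.1, §4.2–4.3; K. Yu, Acta Math. 211 (2013) §5.
-/

noncomputable section

open NormedSpace Finset Polynomial
open scoped Matrix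
open Literature.NumberTheory.Transcendental
open Literature.NumberTheory.Transcendental.PadicCW77 (condExp)
open Literature.NumberTheory.Transcendental.CW77.Setup (Tau tauNorm)
open Summit.ABC.StewartYu.FeldmanBasis (feldR)
open scoped Nat

namespace Summit.ABC.StewartYu

namespace G3Setup

variable {p : ℕ} [Fact p.Prime] (S : G3Setup p) {ι : Type*}

/-! ### The half-step package -/

/-- The signed summand of the PM class sums for an arbitrary exponent vector `w` (uniform form of `LvInvSatI.htermS`):
`Hasse_{t₀}Rᵢ(s₁/2) · ∏ₖ zγ(w)ₖ^{tₖ} · ∏ⱼ θⱼ^{⌊wⱼ s₁/2⌋}`. [folklore] -/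
def htermSW (R : ι → ℚ[X]) (s₁ : ℤ) (τ : Tau S.n) (i : ι) (w : Fin S.n → ℤ) : ℚ :=
  ((hasseDeriv τ.1 (R i)).eval ((s₁ : ℚ) / 2) * ∏ k, S.zγ w k ^ τ.2 k) * ∏ j, S.α j ^ (w j * s₁ / 2)

/-- `htermS R v s₁ τ i = htermSW R s₁ τ i (v i)`. [folklore] -/
theorem htermS_eq_htermSW (R : ι → ℚ[X]) (v : ι → Fin S.n → ℤ) (s₁ : ℤ) (τ : Tau S.n) (i : ι) :
    LvInvSatI.htermS S R v s₁ τ i = S.htermSW R s₁ τ i (v i) := by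
  unfold LvInvSatI.htermS htermSW zγpow; rfl

/-- **Record package of the Kummer half-step of the saturated frame at a level** (`|x| ≤ N` → odd `|x| ≤ 2N₁−1`, orders `T → T′`, next
polynomials `R′`), uniform over `i ∈ U`, the θ-box `L` and the virtual box `Bv`. [cite: Nesterenko2003, §4.3; shape only] -/
def HalfStepHypSatU (F : S.SatData) (R R' : ι → ℚ[X]) (U : Finset ι) (L Bv : Fin S.n → ℕ) (P : ℤ) (m N N₁ T T' : ℕ) : Prop :=
  ∃ (t : ℕ) (Bw : ℝ) (c : ℕ → ℚ) (D : ℤ → Tau S.n → ℕ) (Mh : ℤ → Tau S.n → ℝ),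
    1 ≤ t ∧ T' + t ≤ T ∧ 0 ≤ Bw ∧
    (∀ i ∈ U, ∀ t₀ k, ‖(hw (p := p) R i t₀).coeff k‖ * ((p : ℝ) ^ m * Real.sqrt p) ^ k ≤ Bw) ∧
    (∀ t₀, c t₀ ≠ 0) ∧
    (∀ i ∈ U, ∀ (t₀ : ℕ) (s₁ : ℤ), (hasseDeriv t₀ (R i)).eval ((s₁ : ℚ) / 2) = c t₀ * (hasseDeriv t₀ (R' i)).eval (s₁ : ℚ)) ∧
    (∀ s₁ τ, 1 ≤ D s₁ τ) ∧ (∀ s₁ τ, 0 ≤ Mh s₁ τ) ∧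
    (∀ (s₁ : ℤ) (τ : Tau S.n), ∀ i ∈ U, ∀ w : Fin S.n → ℤ, (∀ j, |w j| ≤ (L j : ℤ)) → (∀ j, |(w ᵥ* F.U) j| ≤ (Bv j : ℤ)) →
      ∃ z : ℤ, (D s₁ τ : ℚ) * S.htermSW R s₁ τ i w = z) ∧
    (∀ (s₁ : ℤ) (τ : Tau S.n), ∀ i ∈ U, ∀ w : Fin S.n → ℤ, (∀ j, |w j| ≤ (L j : ℤ)) → (∀ j, |(w ᵥ* F.U) j| ≤ (Bv j : ℤ)) →
      |(S.htermSW R s₁ τ i w : ℝ)| ≤ Mh s₁ τ) ∧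
    (∀ s₁ : ℤ, Odd s₁ → |s₁| ≤ (2 * N₁ - 1 : ℤ) → ∀ τ : Tau S.n, tauNorm τ + t ≤ T →
      max (Bw * ‖S.Λ / (S.b S.j₀ : ℚ_[p])‖ * (p : ℝ) ^ ((t - 1) / 2) * (p : ℝ) ^ condExp p (2 * N + 1) t)
        (Bw / ((p : ℝ) ^ m * Real.sqrt p) ^ ((2 * N + 1) * t)) <
      (D s₁ τ : ℝ) / (4 * (D s₁ τ : ℝ) ^ 2 * (1 + (U.card : ℝ) * P * Mh s₁ τ) * CW77.heightProd S.α ^ 3) ^ (2 ^ (S.n + 1)))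

namespace LvInvSatI

variable {S} {F : S.SatData} {R R' : ι → ℚ[X]} {U B : Finset ι} {v : ι → Fin S.n → ℤ} {sgn pv : ι → ℤ} {lo : Fin S.n → ℤ}
  {L : Fin S.n → ℕ} {vlo : Fin S.n → ℤ} {Bv : Fin S.n → ℕ} {P : ℤ} {m N N₁ T T' : ℕ}

/-- **Kummer half-step of the saturated frame from the uniform package** (new unknown set `pivotClass ⊆ B ⊆ U`).
[cite: Nesterenko2003, §4.3] -/
theorem halfStep_of_hypU [DecidableEq ι] (hBU : B ⊆ U) (h : S.LvInvSatI F R B v sgn pv lo L vlo Bv P m {x : ℤ | |x| ≤ (N : ℤ)} T)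
    (hΛ : ‖S.Λ / (S.b S.j₀ : ℚ_[p])‖ ≤ (p : ℝ)⁻¹) (hΛm : ‖S.Λ / (S.b S.j₀ : ℚ_[p])‖ ≤ (p : ℝ)⁻¹ ^ (m + 1))
    {ζ : ℚ_[p]} (hζ : IsPrimitiveRoot ζ (p - 1)) (hζM : ζ ^ ((p - 1) / 2) = -1) (hζ1 : ‖ζ‖ = 1) (r : Fin S.n → ℕ)
    (hη : ∀ j, S.η j = ζ ^ r j)
    (hind : ∀ T₁ : Finset (Fin S.n), T₁.Nonempty → ¬ IsSquare (∏ j ∈ T₁, S.α j) ∧ ¬ IsSquare (-∏ j ∈ T₁, S.α j))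
    (H : S.HalfStepHypSatU F R R' U L Bv P m N N₁ T T') :
    ∃ i₀ ∈ B, pv i₀ ≠ 0 ∧
      S.LvInvSatI F R' (S.pivotClass v sgn B i₀) (S.halfDiff v i₀) (S.sgnOf (S.halfDiff v i₀)) pv
        (fun j => -((v i₀ j - lo j) / 2)) (fun j => L j / 2)
        (fun j => -(((v i₀ ᵥ* F.U) j - vlo j) / 2)) (fun j => Bv j / 2) P m {x : ℤ | Odd x ∧ |x| ≤ (2 * N₁ - 1 : ℤ)} T' := by
  obtain ⟨t, Bw, c, D, Mh, ht, hT, hBw0, hBw, hc, hRR', hD, hMh, hint, hsize, hineq⟩ := H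
  obtain ⟨i₀, hi₀B, hi₀⟩ := h.toI.nonzero
  have hP0 : (0 : ℝ) ≤ P := by
    have := h.toI.bound i₀ hi₀B; exact_mod_cast (abs_nonneg _).trans this
  have hMb1 : ∀ s₁ τ, (1 : ℝ) ≤ 1 + (U.card : ℝ) * P * Mh s₁ τ := fun s₁ τ => by
    have : 0 ≤ (U.card : ℝ) * P * Mh s₁ τ := by have := hMh s₁ τ; positivity
    linarith
  refine h.halfStep hΛ hΛm hζ hζM hζ1 r hη hind ht hT hBw0 (fun i hi => hBw i (hBU hi)) c hc (fun i hi => hRR' i (hBU hi)) D hD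
    (fun s₁ τ => 1 + (U.card : ℝ) * P * Mh s₁ τ) hMb1 (fun s₁ τ i hi => ?_) ?_ hineq
  · rw [S.htermS_eq_htermSW]
    exact hint s₁ τ i (hBU hi) (v i) (h.toI.abs_le i hi) (h.vabs_le i hi)
  intro s₁ τ
  have hterm_le : ∀ i ∈ B, |((pv i : ℚ) * htermS S R v s₁ τ i : ℝ)| ≤ P * Mh s₁ τ := by
    intro i hi
    push_cast
    rw [abs_mul]
    have h1 : |((pv i : ℚ) : ℝ)| ≤ P := by
      rw [Rat.cast_intCast, ← Int.cast_abs]; exact_mod_cast h.toI.bound i hi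
    have h2 : |(htermS S R v s₁ τ i : ℝ)| ≤ Mh s₁ τ := by
      rw [S.htermS_eq_htermSW]; exact hsize s₁ τ i (hBU hi) (v i) (h.toI.abs_le i hi) (h.vabs_le i hi)
    exact mul_le_mul h1 h2 (abs_nonneg _) hP0
  calc ∑ i ∈ B, |((pv i : ℚ) * htermS S R v s₁ τ i : ℝ)| ≤ ∑ i ∈ B, (P : ℝ) * Mh s₁ τ := sum_le_sum hterm_le
    _ = (B.card : ℝ) * P * Mh s₁ τ := by rw [sum_const, nsmul_eq_mul]; ring
    _ ≤ (U.card : ℝ) * P * Mh s₁ τ := mul_le_mul_of_nonneg_right (LvInvI.card_mul_le_of_subset hBU hP0) (hMh s₁ τ)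
    _ ≤ 1 + (U.card : ℝ) * P * Mh s₁ τ := by linarith

end LvInvSatI

/-! ### The level schedule of the saturated frame -/

/-- **The state at the end of a level of the saturated frame**: some sub-family of `U` with exponents injective in `i.2` satisfying `LvInvSatI`
with the level polynomials `Rl H Ŝ lev`, the θ-box `Lb Lc lev` and the virtual box `Lb sv lev`. [folklore] -/
def LevelStateSat (F : S.SatData) (H Sh : ℕ) (Lc sv : Fin S.n → ℕ) (U : Finset (ℕ × (Fin S.n → ℤ))) (pv : ℕ × (Fin S.n → ℤ) → ℤ) (P : ℤ)
    (m lev N T : ℕ) : Prop :=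
  ∃ (B : Finset (ℕ × (Fin S.n → ℤ))) (v : ℕ × (Fin S.n → ℤ) → Fin S.n → ℤ) (sgn : ℕ × (Fin S.n → ℤ) → ℤ) (lo vlo : Fin S.n → ℤ),
    B ⊆ U ∧ (∀ i ∈ B, ∀ i' ∈ B, v i = v i' ↔ i.2 = i'.2) ∧
    S.LvInvSatI F (S.Rl H Sh lev) B v sgn pv lo (S.Lb Lc lev) vlo (S.Lb sv lev) P m {x : ℤ | |x| ≤ (N : ℤ)} T

variable {S}

/-- **One level up in the saturated frame**: `(lev, n) → (lev+1, n)` = half-step + odd-node k-step + `n − 1` k-steps.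
[cite: Nesterenko2003, §4.2–4.3] -/
theorem levelUpSat {F : S.SatData} {H Sh : ℕ} {Lc sv : Fin S.n → ℕ} {U : Finset (ℕ × (Fin S.n → ℤ))} {pv : ℕ × (Fin S.n → ℤ) → ℤ} {P : ℤ}
    {m : ℕ} (hn : 1 ≤ S.n) (hΛ : ‖S.Λ / (S.b S.j₀ : ℚ_[p])‖ ≤ (p : ℝ)⁻¹) (hΛm : ‖S.Λ / (S.b S.j₀ : ℚ_[p])‖ ≤ (p : ℝ)⁻¹ ^ (m + 1))
    {ζ : ℚ_[p]} (hζ : IsPrimitiveRoot ζ (p - 1)) (hζM : ζ ^ ((p - 1) / 2) = -1) (hζ1 : ‖ζ‖ = 1) (r : Fin S.n → ℕ)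
    (hη : ∀ j, S.η j = ζ ^ r j)
    (hind : ∀ T₁ : Finset (Fin S.n), T₁.Nonempty → ¬ IsSquare (∏ j ∈ T₁, S.α j) ∧ ¬ IsSquare (-∏ j ∈ T₁, S.α j))
    (N T : ℕ → ℕ → ℕ) (Nh : ℕ → ℕ) (lev : ℕ)
    (hH : S.HalfStepHypSatU F (S.Rl H Sh lev) (S.Rl H Sh (lev + 1)) U (S.Lb Lc lev) (S.Lb sv lev) P m (N lev S.n) (Nh (lev + 1))
      (T lev S.n) (T (lev + 1) 0))
    (hO : S.KStepOddHypSatU F (S.Rl H Sh (lev + 1)) U (S.Lb Lc (lev + 1)) (S.Lb sv (lev + 1)) P m (Nh (lev + 1)) (N (lev + 1) 1)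
      (T (lev + 1) 0) (T (lev + 1) 1))
    (hK : ∀ ν, 1 ≤ ν → ν < S.n → S.KStepHypSatU F (S.Rl H Sh (lev + 1)) U (S.Lb Lc (lev + 1)) (S.Lb sv (lev + 1)) P m (N (lev + 1) ν)
      (N (lev + 1) (ν + 1)) (T (lev + 1) ν) (T (lev + 1) (ν + 1)))
    (hst : S.LevelStateSat F H Sh Lc sv U pv P m lev (N lev S.n) (T lev S.n)) :
    S.LevelStateSat F H Sh Lc sv U pv P m (lev + 1) (N (lev + 1) S.n) (T (lev + 1) S.n) := by
  classical
  obtain ⟨B, v, sgn, lo, vlo, hBU, hinj, h⟩ := hst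
  obtain ⟨i₀, hi₀B, _, h1⟩ := LvInvSatI.halfStep_of_hypU hBU h hΛ hΛm hζ hζM hζ1 r hη hind hH
  have hB'U : S.pivotClass v sgn B i₀ ⊆ U := (S.pivotClass_subset v sgn B i₀).trans hBU
  have h2 := LvInvSatI.kstep_odd_of_hypU hB'U h1 hΛ hO
  have h3 := LvInvSatI.kchain hB'U hΛ (N (lev + 1)) (T (lev + 1)) 1 (S.n - 1) (fun ν h0 h1 => hK ν h0 (by omega)) h2
  rw [show 1 + (S.n - 1) = S.n by omega] at h3
  refine ⟨S.pivotClass v sgn B i₀, S.halfDiff v i₀, S.sgnOf (S.halfDiff v i₀), _, _, hB'U, ?_, h3⟩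
  -- injectivity of the new exponents in `λ`
  intro i hi i' hi'
  have hiB : i ∈ B := S.pivotClass_subset v sgn B i₀ hi
  have hi'B : i' ∈ B := S.pivotClass_subset v sgn B i₀ hi'
  have hpar : ∀ j, 2 ∣ v i j - v i₀ j := (S.mem_pivotClass.mp hi).2.1
  have hpar' : ∀ j, 2 ∣ v i' j - v i₀ j := (S.mem_pivotClass.mp hi').2.1
  rw [← hinj i hiB i' hi'B]
  constructor
  · intro hw
    have e1 := S.eq_add_two_smul_halfDiff v i₀ hpar (i := i)
    have e2 := S.eq_add_two_smul_halfDiff v i₀ hpar' (i := i')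
    rw [e1, e2, hw]
  · intro hv
    funext j; simp only [halfDiff, hv]

/-- **All the levels of the saturated frame.** [cite: Nesterenko2003, Prop 4.1] -/
theorem levelsSat {F : S.SatData} {H Sh : ℕ} {Lc sv : Fin S.n → ℕ} {U : Finset (ℕ × (Fin S.n → ℤ))} {pv : ℕ × (Fin S.n → ℤ) → ℤ} {P : ℤ}
    {m : ℕ} (hn : 1 ≤ S.n) (hΛ : ‖S.Λ / (S.b S.j₀ : ℚ_[p])‖ ≤ (p : ℝ)⁻¹) (hΛm : ‖S.Λ / (S.b S.j₀ : ℚ_[p])‖ ≤ (p : ℝ)⁻¹ ^ (m + 1))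
    {ζ : ℚ_[p]} (hζ : IsPrimitiveRoot ζ (p - 1)) (hζM : ζ ^ ((p - 1) / 2) = -1) (hζ1 : ‖ζ‖ = 1) (r : Fin S.n → ℕ)
    (hη : ∀ j, S.η j = ζ ^ r j)
    (hind : ∀ T₁ : Finset (Fin S.n), T₁.Nonempty → ¬ IsSquare (∏ j ∈ T₁, S.α j) ∧ ¬ IsSquare (-∏ j ∈ T₁, S.α j))
    (N T : ℕ → ℕ → ℕ) (Nh : ℕ → ℕ)
    (hH : ∀ lev < Sh, S.HalfStepHypSatU F (S.Rl H Sh lev) (S.Rl H Sh (lev + 1)) U (S.Lb Lc lev) (S.Lb sv lev) P m (N lev S.n)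
      (Nh (lev + 1)) (T lev S.n) (T (lev + 1) 0))
    (hO : ∀ lev < Sh, S.KStepOddHypSatU F (S.Rl H Sh (lev + 1)) U (S.Lb Lc (lev + 1)) (S.Lb sv (lev + 1)) P m (Nh (lev + 1))
      (N (lev + 1) 1) (T (lev + 1) 0) (T (lev + 1) 1))
    (hK : ∀ lev < Sh, ∀ ν, 1 ≤ ν → ν < S.n → S.KStepHypSatU F (S.Rl H Sh (lev + 1)) U (S.Lb Lc (lev + 1)) (S.Lb sv (lev + 1)) P m
      (N (lev + 1) ν) (N (lev + 1) (ν + 1)) (T (lev + 1) ν) (T (lev + 1) (ν + 1)))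
    (h0 : S.LevelStateSat F H Sh Lc sv U pv P m 0 (N 0 S.n) (T 0 S.n)) :
    ∀ lev ≤ Sh, S.LevelStateSat F H Sh Lc sv U pv P m lev (N lev S.n) (T lev S.n) := by
  intro lev
  induction lev with
  | zero => intro _; exact h0
  | succ lev ih =>
    intro hle
    exact levelUpSat hn hΛ hΛm hζ hζM hζ1 r hη hind N T Nh lev (hH lev (by omega)) (hO lev (by omega)) (hK lev (by omega))
      (ih (by omega))

end G3Setup

end Summit.ABC.StewartYu

end
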